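import Summits.NavierStokesRegularity.NavierStokesRegularity.Theorems.SqueezeCycleRecurrentLiouvilleGkWindowIncrementRemoval
import Summits.NavierStokesRegularity.NavierStokesRegularity.Theorems.SqueezeCycleRecurrentLiouvilleShrinkingOrbit
import Summits.NavierStokesRegularity.NavierStokesRegularity.Theorems.RecurrentProfilesRecurrentReductionOrbit
import HarnessLib

/-!
# Crux `RecurrentLiouville` (stmt-NavierStokesRegularity-1589), line `Sketch` (v7) —
# stub S2 `stub_frEpochRemoval`: near-stationary epoch removal in `L³(Q(0,1))` form

Theorems-only file (no definitions, no named facts).  **Near-stationary epoch removal.**  For every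
rate `C` and bound `M < ⊤` there are `W > 0` and `θ > 0` such that a suitable weak solution `(u, p)`
of Navier–Stokes (`ν = 1`) on `ℝ³ × ℝ₋` with weak gradient `G`, Albritton–Barker quantity `𝐈 ≤ M`
and the Type-I rate `‖u(t,x)‖ ≤ C/√(−t)`, whose scaling orbit `s ↦ u_{e^s}`,
`u_c(t,x) = c u(c²t, cx)`, stays `θ`-close to `u` in `L³(Q(0,1))` over the whole log-scale epoch
`s ∈ [0, W]`, is regular at the space–time origin.

Proof.  Let `R, δ` be the constants of the window increment removal theorem
`stub_gkWindowIncrementRemoval` (skeleton v6, stub S1): increments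
`∫_{(−2,−1)×B_R} ‖u_c − u‖² ≤ δ` for all `1 ≤ c ≤ √2` force regularity.  Put `R' = max R 2`,
`W = log R' + 1`.  For `1 ≤ c ≤ √2` the box `(−2,−1) × B_R` lies in `Q(0,R')`, Hölder gives
`‖u_c − u‖_{L²(Q(0,R'))} ≤ |Q(0,R')|^{1/6} ‖u_c − u‖_{L³(Q(0,R'))}`, and the exact scaling law of
`L³` distances under the zoom by `R'` (`eLpNorm_zoom_sub_zoom`) turns the last norm into
`Z(R')⁻¹ ‖u_{cR'} − u_{R'}‖_{L³(Q(0,1))} ≤ Z(R')⁻¹ (‖u_{cR'} − u‖ + ‖u − u_{R'}‖) ≤ 2 Z(R')⁻¹ θ`,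
both log-scales `log (cR')`, `log R'` lying in `[0, W]`.  A suitable `θ = θ(R, δ)` makes the
increments `≤ δ`.

## References

* T.-P. Tsai, Arch. Rational Mech. Anal. 143 (1998), Thm 1. [Tsai1998]
* D. Albritton, T. Barker, J. Math. Fluid Mech. 21 (2019), Lemma 2.2, Prop. 2.3, §3.
  [AlbrittonBarker2019]
* J. Leray, Acta Math. 63 (1934), §20 (the scaling). [Leray1934]
-/

noncomputable section

-- the sub-problem namespace repeats the summit name (D-0017 layout `Summit.<S>.<P>.Theorems`)
set_option linter.dupNamespace false

namespace Summit.NavierStokesRegularity.NavierStokesRegularity.Theorems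

open MeasureTheory Set Function Filter Topology TopologicalSpace Metric
open Literature.Analysis Literature.Analysis.FluidPDE
open scoped NNReal ENNReal

variable {u : ℝ → EuclideanSpace ℝ (Fin 3) → EuclideanSpace ℝ (Fin 3)}
  {p : ℝ → EuclideanSpace ℝ (Fin 3) → ℝ}
  {G : ℝ → EuclideanSpace ℝ (Fin 3) → EuclideanSpace ℝ (Fin 3) →L[ℝ] EuclideanSpace ℝ (Fin 3)}

/-! ### Bookkeeping lemmas -/

/-- The scaling constant `c (c⁵)^{-1/3}` of `eLpNorm_zoom_sub_zoom` is nonzero for `c > 0`.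
[folklore] -/
private theorem frEpochRemoval_zoomConst_ne_zero {c : ℝ} (hc : 0 < c) :
    ‖c‖ₑ * (ENNReal.ofReal (c ^ 2 * c ^ 3)⁻¹) ^ (1 / (3 : ℝ≥0∞).toReal) ≠ 0 := by
  refine mul_ne_zero ?_ ?_
  · simpa using hc.ne'
  · exact (ENNReal.rpow_pos (ENNReal.ofReal_pos.2 (by positivity)) ENNReal.ofReal_ne_top).ne'

/-- Rescaled slab profiles are (strongly) measurable on the parabolic balls `Q(0, r)`: the zoom
`c u ∘ Φ_c` is again a slab profile with a weak gradient, hence locally integrable on the slab.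
[cite: AlbrittonBarker2019, §3] -/
private theorem frEpochRemoval_aesm_nsRescale
    (hsw : IsSuitableWeakSolutionOn (slab (EuclideanSpace ℝ (Fin 3)) (Iio 0) isOpen_Iio) 1 0 u p)
    (hwg : HasWeakSpatialGradientOn (slab (EuclideanSpace ℝ (Fin 3)) (Iio 0) isOpen_Iio) u G)
    {c : ℝ} (hc : 0 < c) (r : ℝ) :
    AEStronglyMeasurable (uncurry (nsRescale c u))
      (volume.restrict (parabolicCylinder r (0 : ℝ × EuclideanSpace ℝ (Fin 3)))) := by
  rw [nsRescale_eq_zoom]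
  exact (zoom_slabProfile hsw hwg hc).2.1.locallyIntegrableOn.aestronglyMeasurable.mono_measure
    (Measure.restrict_mono (parabolicCylinder_origin_subset_slab _) le_rfl)

/-- Slab profiles are (strongly) measurable on the parabolic balls `Q(0, r)`. [folklore] -/
private theorem frEpochRemoval_aesm
    (hwg : HasWeakSpatialGradientOn (slab (EuclideanSpace ℝ (Fin 3)) (Iio 0) isOpen_Iio) u G)
    (r : ℝ) :
    AEStronglyMeasurable (uncurry u)
      (volume.restrict (parabolicCylinder r (0 : ℝ × EuclideanSpace ℝ (Fin 3)))) :=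
  hwg.locallyIntegrableOn.aestronglyMeasurable.mono_measure
    (Measure.restrict_mono (parabolicCylinder_origin_subset_slab _) le_rfl)

/-- The window box `(−2,−1) × B_R` lies in the parabolic ball `Q(0, R')` once `R ≤ R'` and
`2 ≤ R'`. [folklore] -/
private theorem frEpochRemoval_box_subset {R R' : ℝ} (hRR' : R ≤ R') (h2 : 2 ≤ R') :
    Ioo (-2 : ℝ) (-1) ×ˢ Metric.ball (0 : EuclideanSpace ℝ (Fin 3)) R ⊆
      parabolicCylinder R' (0 : ℝ × EuclideanSpace ℝ (Fin 3)) := by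
  rintro ⟨t, x⟩ ⟨⟨ht1, ht2⟩, hx⟩
  rw [mem_ball_zero_iff] at hx
  rw [SuitableCompactness.mem_parabolicCylinder_zero]
  refine ⟨⟨?_, ?_⟩, hx.trans_le hRR'⟩
  · show -R' ^ 2 < t
    nlinarith
  · show t < 0
    linarith

/-! ### The stub -/

/-- **S2 — near-stationary epoch removal** (registered stub of crux stmt-NavierStokesRegularity-1589,
line Sketch v7).  For every rate `C` and bound `M < ⊤` there are `W > 0`, `θ > 0` such that a class
member (suitable weak on `ℝ³ × ℝ₋`, weak gradient, `𝐈 ≤ M`, rate `C`) whose scaling orbit stays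
`θ`-close to it in `L³(Q(0,1))` over the log-scale epoch `[0, W]` is regular at the origin: zoom by
`R' = max R 2` (`W = log R' + 1`), compare `L³(Q(0,R'))` with `L²` on the box `(−2,−1) × B_R`, and
apply the window increment removal `stub_gkWindowIncrementRemoval`.
[cite: AlbrittonBarker2019, Prop. 2.3; Tsai1998, Thm 1] -/
theorem stub_frEpochRemoval :
    ∀ (C : ℝ) (M : ℝ≥0∞), M < ⊤ → ∃ W : ℝ, 0 < W ∧ ∃ θ : ℝ, 0 < θ ∧
      ∀ (u : ℝ → EuclideanSpace ℝ (Fin 3) → EuclideanSpace ℝ (Fin 3))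
        (p : ℝ → EuclideanSpace ℝ (Fin 3) → ℝ)
        (G : ℝ → EuclideanSpace ℝ (Fin 3) → EuclideanSpace ℝ (Fin 3) →L[ℝ] EuclideanSpace ℝ (Fin 3)),
        IsSuitableWeakSolutionOn (slab (EuclideanSpace ℝ (Fin 3)) (Iio 0) isOpen_Iio) 1 0 u p →
        HasWeakSpatialGradientOn (slab (EuclideanSpace ℝ (Fin 3)) (Iio 0) isOpen_Iio) u G →
        typeIBound (Iio (0 : ℝ) ×ˢ univ) u p G ≤ M →
        HasTypeITimeDecay C u →
        (∀ s ∈ Icc (0 : ℝ) W,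
          eLpNorm (uncurry (nsRescale (Real.exp s) u) - uncurry u) 3
            (volume.restrict (parabolicCylinder 1 (0 : ℝ × EuclideanSpace ℝ (Fin 3)))) ≤
              ENNReal.ofReal θ) →
        ¬ IsBackwardSingularPoint u 0 := by
  intro C M hM
  obtain ⟨R, hR, δ, hδ, hrem⟩ := stub_gkWindowIncrementRemoval C M hM
  -- the zoom radius `R' = max R 2` and the parabolic ball `Q = Q(0, R')`
  obtain ⟨R', hRR', h2R'⟩ : ∃ R' : ℝ, R ≤ R' ∧ 2 ≤ R' := ⟨max R 2, le_max_left _ _, le_max_right _ _⟩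
  have hR'pos : 0 < R' := by linarith
  have hR'1 : 1 ≤ R' := by linarith
  set Q : Set (ℝ × EuclideanSpace ℝ (Fin 3)) := parabolicCylinder R' (0 : ℝ × EuclideanSpace ℝ (Fin 3))
    with hQ
  -- the zoom constant `Z = R' (R'⁵)^{-1/3}` of the exact scaling law
  obtain ⟨Z, hZ0, hZtop, hZeq⟩ : ∃ Z : ℝ≥0∞, Z ≠ 0 ∧ Z ≠ ⊤ ∧
      ∀ v w : ℝ → EuclideanSpace ℝ (Fin 3) → EuclideanSpace ℝ (Fin 3),
        eLpNorm (uncurry (nsRescale R' v) - uncurry (nsRescale R' w)) 3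
            (volume.restrict (parabolicCylinder 1 (0 : ℝ × EuclideanSpace ℝ (Fin 3)))) =
          Z * eLpNorm (uncurry v - uncurry w) 3 (volume.restrict Q) :=
    ⟨_, frEpochRemoval_zoomConst_ne_zero hR'pos, zoomConst_ne_top R', fun v w => by
      rw [nsRescale_eq_zoom, nsRescale_eq_zoom, eLpNorm_zoom_sub_zoom v w hR'pos 1, mul_one]⟩
  -- the Hölder constant `V = |Q(0,R')|^{1/2 - 1/3}`
  set V : ℝ≥0∞ := (volume.restrict Q) univ ^ (1 / (2 : ℝ≥0∞).toReal - 1 / (3 : ℝ≥0∞).toReal)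
    with hV
  have hVtop : V ≠ ⊤ := by
    refine ENNReal.rpow_ne_top_of_nonneg (by norm_num) ?_
    rw [Measure.restrict_apply_univ]
    exact SuitableCompactness.volume_parabolicCylinder_zero_ne_top R'
  -- the constant `K = 2 Z⁻¹ V` and the choice of `θ`
  set K : ℝ≥0∞ := Z⁻¹ * 2 * V with hK
  have hKtop : K ≠ ⊤ :=
    ENNReal.mul_ne_top (ENNReal.mul_ne_top (ENNReal.inv_ne_top.2 hZ0) ENNReal.ofNat_ne_top) hVtop
  have hK2top : K ^ 2 ≠ ⊤ := ENNReal.pow_ne_top hKtop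
  set k : ℝ := (K ^ 2).toReal with hk
  have hk0 : 0 ≤ k := ENNReal.toReal_nonneg
  have hk1 : 0 < k + 1 := by linarith
  have hkK : ENNReal.ofReal k = K ^ 2 := ENNReal.ofReal_toReal hK2top
  set θ : ℝ := min 1 (δ / (k + 1)) with hθ
  have hθpos : 0 < θ := lt_min one_pos (div_pos hδ hk1)
  have hθ1 : θ ≤ 1 := min_le_left _ _
  have hkθ : k * θ ≤ δ := by
    calc k * θ ≤ k * (δ / (k + 1)) := mul_le_mul_of_nonneg_left (min_le_right _ _) hk0
      _ = k * δ / (k + 1) := (mul_div_assoc _ _ _).symm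
      _ ≤ δ := by
          rw [div_le_iff₀ hk1]
          nlinarith
  have hlogR' : 0 ≤ Real.log R' := Real.log_nonneg hR'1
  refine ⟨Real.log R' + 1, by linarith, θ, hθpos, ?_⟩
  intro u p G hsw hwg hI hdec hyp
  refine hrem u p G hsw hwg hI hdec fun c hc1 hc2 => ?_
  have hc : 0 < c := one_pos.trans_le hc1
  -- the two log-scales `log (c R')`, `log R'` lie in the epoch `[0, W]`
  have hlogc : 0 ≤ Real.log c := Real.log_nonneg hc1
  have hc_le : c ≤ 2 := by nlinarith
  have hlogc1 : Real.log c ≤ 1 := by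
    have h := Real.log_le_sub_one_of_pos hc
    linarith
  have hs1 : Real.log (c * R') ∈ Icc (0 : ℝ) (Real.log R' + 1) := by
    rw [Real.log_mul hc.ne' hR'pos.ne']
    exact ⟨add_nonneg hlogc hlogR', by linarith⟩
  have hs2 : Real.log R' ∈ Icc (0 : ℝ) (Real.log R' + 1) := ⟨hlogR', by linarith⟩
  have h1 := hyp _ hs1
  have h2 := hyp _ hs2
  rw [Real.exp_log (mul_pos hc hR'pos)] at h1
  rw [Real.exp_log hR'pos] at h2
  -- measurability on the balls
  have hmA := frEpochRemoval_aesm_nsRescale hsw hwg (mul_pos hc hR'pos) 1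
  have hmB := frEpochRemoval_aesm_nsRescale hsw hwg hR'pos 1
  have hmC := frEpochRemoval_aesm_nsRescale hsw hwg hc R'
  have hm1 := frEpochRemoval_aesm hwg 1
  have hmR' := frEpochRemoval_aesm hwg R'
  -- (d) triangle inequality on `Q(0,1)` through `u`, then the zoom by `R'`
  have htri : eLpNorm (uncurry (nsRescale (c * R') u) - uncurry (nsRescale R' u)) 3
      (volume.restrict (parabolicCylinder 1 (0 : ℝ × EuclideanSpace ℝ (Fin 3)))) ≤
      ENNReal.ofReal θ + ENNReal.ofReal θ := by
    have e : uncurry (nsRescale (c * R') u) - uncurry (nsRescale R' u) =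
        (uncurry (nsRescale (c * R') u) - uncurry u) + (uncurry u - uncurry (nsRescale R' u)) := by
      rw [sub_add_sub_cancel]
    rw [e]
    calc eLpNorm ((uncurry (nsRescale (c * R') u) - uncurry u) +
          (uncurry u - uncurry (nsRescale R' u))) 3
          (volume.restrict (parabolicCylinder 1 (0 : ℝ × EuclideanSpace ℝ (Fin 3))))
        ≤ eLpNorm (uncurry (nsRescale (c * R') u) - uncurry u) 3
            (volume.restrict (parabolicCylinder 1 (0 : ℝ × EuclideanSpace ℝ (Fin 3)))) +
          eLpNorm (uncurry u - uncurry (nsRescale R' u)) 3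
            (volume.restrict (parabolicCylinder 1 (0 : ℝ × EuclideanSpace ℝ (Fin 3)))) :=
          eLpNorm_add_le (hmA.sub hm1) (hm1.sub hmB) (by norm_num)
      _ ≤ ENNReal.ofReal θ + ENNReal.ofReal θ := by
          rw [eLpNorm_sub_comm (uncurry u)]
          exact add_le_add h1 h2
  set f : ℝ × EuclideanSpace ℝ (Fin 3) → EuclideanSpace ℝ (Fin 3) :=
    uncurry (nsRescale c u) - uncurry u with hf
  have hX : eLpNorm f 3 (volume.restrict Q) ≤ Z⁻¹ * (ENNReal.ofReal θ + ENNReal.ofReal θ) := by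
    have h := htri
    rw [nsRescale_mul c R' u, hZeq] at h
    calc eLpNorm f 3 (volume.restrict Q) = Z⁻¹ * (Z * eLpNorm f 3 (volume.restrict Q)) := by
          rw [← mul_assoc, ENNReal.inv_mul_cancel hZ0 hZtop, one_mul]
      _ ≤ Z⁻¹ * (ENNReal.ofReal θ + ENNReal.ofReal θ) := mul_le_mul_right h _
  -- (c) Hölder `L² ≤ L³ |Q|^{1/6}` on the finite-measure ball
  have hH : eLpNorm f 2 (volume.restrict Q) ≤ eLpNorm f 3 (volume.restrict Q) * V :=
    eLpNorm_le_eLpNorm_mul_rpow_measure_univ (by norm_num) (hmC.sub hmR')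
  have hθle1 : ENNReal.ofReal θ ≤ 1 := ENNReal.ofReal_le_one.2 hθ1
  -- (a), (b), (e): the box lies in `Q(0,R')`, `∫ ‖f‖² = ‖f‖²_{L²}`, and the choice of `θ`
  calc ∫⁻ z in Ioo (-2 : ℝ) (-1) ×ˢ Metric.ball (0 : EuclideanSpace ℝ (Fin 3)) R,
        ‖nsRescale c u z.1 z.2 - u z.1 z.2‖ₑ ^ 2
      ≤ ∫⁻ z in Q, ‖nsRescale c u z.1 z.2 - u z.1 z.2‖ₑ ^ 2 :=
        lintegral_mono_set (frEpochRemoval_box_subset hRR' h2R')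
    _ = eLpNorm f 2 (volume.restrict Q) ^ 2 := lintegral_enorm_sq_eq_eLpNorm_two_sq _ f
    _ ≤ (eLpNorm f 3 (volume.restrict Q) * V) ^ 2 := by gcongr
    _ ≤ (Z⁻¹ * (ENNReal.ofReal θ + ENNReal.ofReal θ) * V) ^ 2 := by gcongr
    _ = K ^ 2 * (ENNReal.ofReal θ * ENNReal.ofReal θ) := by
        rw [hK, ← two_mul]
        ring
    _ ≤ K ^ 2 * (1 * ENNReal.ofReal θ) := by gcongr
    _ = ENNReal.ofReal (k * θ) := by rw [one_mul, ENNReal.ofReal_mul hk0, hkK]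
    _ ≤ ENNReal.ofReal δ := ENNReal.ofReal_le_ofReal hkθ

end Summit.NavierStokesRegularity.NavierStokesRegularity.Theorems

end
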